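import Literature.MathematicalPhysics.QuantumFieldTheory.BalabanImbrieJaffe1984to88.BIJ88Eq322Identity
import Literature.MathematicalPhysics.QuantumFieldTheory.BalabanImbrieJaffe1984to88.BIJ85BlockAveragesTorus

/-!
# `BalabanImbrieJaffe1984to88.BIJ88Eq322Printed` — T. Bałaban, J. Imbrie, A. Jaffe, *Effective action and cluster properties of
the abelian Higgs model*, Commun. Math. Phys. **114** (1988) 257–315 [BalabanImbrieJaffe1988]: **(3.22) for the PRINTED model and
the PRINTED observables of (3.1), every analytic hypothesis discharged** — the observables *"|φ(x)|², φ̄(b₋)u(b)φ(b₊),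
Re(ieε²)⁻¹(u(p) − 1)"* (with constant Wick subtractions) are jointly measurable, jointly gauge invariant and polynomially bounded,
so the first renormalized density `ρ₁^L = 𝒯ρ₀` of (3.11) EXISTS for them (gen 4 `BIJ85BlockAveragesTorus.isRT311_printed`) and
SATISFIES (3.22) with the constructed terms of `BIJ88Eq322Identity` (file 3 of the (3.22) group; theorems only)

statement-level skeleton of published theorems with citation tags; proofs where landed; nothing here is a claim about the Yang–Mills mass gap

PDF held: `paper:balaban1988-cmp114-bij-abelian-higgs-effective-action` (journal page = PDF page + 256); p. 265 [PDF 9] and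
p. 268 [PDF 12] read as images (`renders/c2-p009.png` of this seat, `HOME/lit-balaban-r16/renders/cmp114/original-p012-x2.png`).

CITATION HEADER (lean-in-tree rule).  Part of the lit-balaban TYPED SKELETON (HOME `run/shared/lean/pub/lit-balaban/`; rows
`C2.Eq3.22` and `C2.Eq3.1` of `HOME/lit-balaban-r18/ROWS-C2.md`; unit `lit-balaban-r18`, gen 6).  WHAT IS REPRODUCED: p. 265
*"[F] = ∫𝒟u𝒟φ e^{−S^ε(u,φ)}F, (3.1) where F is a gauge-invariant function, a product of terms like |φ(x)|², φ̄(b₋)u(b)φ(b₊),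
Re(ieε²)⁻¹(u(p) − 1). Each such term may need to have an appropriate constant subtracted"* and p. 268 (3.22) (quoted in
`BIJ88Eq322Identity`).  PROVED (kernel-checked, 0 sorry, theorems only, standard axioms), for the printed product observables
`BIJ88Eq322Identity.Obs31.printed plaq bond site ε e₀ d (fun i _ => cβ i) cξ` (constant Wick subtractions `cβ`, `cξ`):
gauge invariance of the Wick bond factor (`wickBond_gauge`) and of the observable (`printed_eval_gauge`, `jointInvariant_printed`,
through r18's dictionary `cfg_gaugeAct`/`rot_eq_gaugePhi`), joint continuity/measurability (`continuous_printed_eval`,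
`measurable_printed`), the polynomial bound `‖F(u, φ)‖ ≤ C·Π_x(1 + |φ(x)|)ⁿ` for unit-modulus `u` with explicit `C`, `n`
(`norm_printed_eval_le`, `norm_printed_eval_cfg_le`), whence `isRT311_printed_obs` ((3.11) for `ρ₀ = rho0 … F`, no hypothesis on `F`
left) and **`exists_eq322_printed`**: for `ε, λ, a > 0`, `d ≥ 2`, the standing level range, ANY Wick constants, cube structure
`(κ, R, cube)`, characteristic values `χ`, `n̄` and distribution `E₁(x)` of `E₁`, THERE IS `ρ₁^L` with (3.11) AND (3.22).
NOT HERE: bounds; u-dependent Wick subtractions (data of `Obs31.printed` in general; here constants).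
-/

namespace Literature.MathematicalPhysics.QuantumFieldTheory.BalabanImbrieJaffe1984to88.BIJ88Eq322Printed

open Literature.MathematicalPhysics.QuantumFieldTheory.Balaban1983to89
open Literature.Probability.LatticeModels (rcomponents IsRConnected)
open BIJ88Sect3Statements
open BIJ88RenormTransf311 (gaussWeight rho0 IsRT311 Term322 density322 Eq322 eq322_iff_isRT311 cfg_gaugeAct rot_eq_gaugePhi)
open BIJ88Eq322Identity
open BIJ85Sect1Model (HiggsField)
open BIJ85RT33 (JointInvariant twist)
open scoped BigOperators
open Complex Finset

noncomputable section

variable {P : Params} {j : ℕ}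
variable {ιπ ιβ ιξ : Type} [Fintype ιπ] [DecidableEq ιπ] [Fintype ιβ] [Fintype ιξ]
variable (plaq : ιπ → Balaban1983to89.Plaq P j) (bond : ιβ → PBond P j) (site : ιξ → Balaban1983to89.Site P j)
variable (ε e₀ : ℝ) (d : ℕ) (cβ : ιβ → ℂ) (cξ : ιξ → ℂ)

/-- plumbing: `|e^{it}| = 1`. [folklore] -/
private theorem norm_phase (t : ℝ) : ‖exp ((t : ℂ) * I)‖ = 1 := by
  rw [mul_comm]; exact norm_exp_I_mul_ofReal t

/-- The bond factor `φ̄(b₋)u(b)φ(b₊)` of (3.1) is gauge INVARIANT (`φ ↦ e^{iλ}φ`, `u(b) ↦ e^{iλ(b₋)}u(b)e^{−iλ(b₊)}`).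
[cite: BalabanImbrieJaffe1988, (3.1) p.265] -/
theorem wickBond_gauge (lam : Balaban1983to89.Site P j → ℝ) (u : PBond P j → ℂ) (φ : HiggsField P j) (b : PBond P j) :
    (starRingEnd ℂ) (gaugePhi lam φ b.src) * gaugeU lam u b * gaugePhi lam φ b.tgt =
      (starRingEnd ℂ) (φ b.src) * u b * φ b.tgt := by
  simp only [gaugePhi, gaugeU, map_mul]
  have hc : (starRingEnd ℂ) (exp ((lam b.src : ℂ) * I)) = exp (-((lam b.src : ℂ) * I)) := by
    rw [← exp_conj]; simp [conj_ofReal]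
  have k1 : exp (-((lam b.src : ℂ) * I)) * exp ((lam b.src : ℂ) * I) = 1 := by rw [← exp_add]; simp
  have k2 : exp (-((lam b.tgt : ℂ) * I)) * exp ((lam b.tgt : ℂ) * I) = 1 := by rw [← exp_add]; simp
  rw [hc]
  calc exp (-((lam b.src : ℂ) * I)) * (starRingEnd ℂ) (φ b.src) *
        (exp ((lam b.src : ℂ) * I) * u b * exp (-((lam b.tgt : ℂ) * I))) * (exp ((lam b.tgt : ℂ) * I) * φ b.tgt)
      = (exp (-((lam b.src : ℂ) * I)) * exp ((lam b.src : ℂ) * I)) * (exp (-((lam b.tgt : ℂ) * I)) * exp ((lam b.tgt : ℂ) * I))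
          * ((starRingEnd ℂ) (φ b.src) * u b * φ b.tgt) := by ring
    _ = _ := by rw [k1, k2, one_mul, one_mul]

/-- *"F is a gauge-invariant function"* (p. 265): the printed product observable with constant Wick subtractions is invariant under
the gauge transformations of `BIJ88Sect3Statements` (`plaqVar_gauge`, `wickBond_gauge`, `|e^{iλ}φ| = |φ|`). [cite: BalabanImbrieJaffe1988, (3.1) p.265] -/
theorem printed_eval_gauge (lam : Balaban1983to89.Site P j → ℝ) (u : PBond P j → ℂ) (φ : HiggsField P j) :
    (Obs31.printed plaq bond site ε e₀ d (fun i _ => cβ i) cξ).eval (gaugeU lam u) (gaugePhi lam φ) =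
      (Obs31.printed plaq bond site ε e₀ d (fun i _ => cβ i) cξ).eval u φ := by
  simp only [Obs31.eval, Obs31.printed, plaqVar_gauge, wickBond_gauge]
  congr 1
  refine prod_congr rfl fun i _ => ?_
  simp only [gaugePhi, norm_mul, norm_phase, one_mul]

/-- … hence `JointInvariant` on `U(1)` configurations (r18's dictionary `cfg_gaugeAct`/`rot_eq_gaugePhi`) — the hypothesis `hFg` of
`isRT311_printed`. [cite: BalabanImbrieJaffe1988, (3.1) p.265] -/
theorem jointInvariant_printed :
    JointInvariant (fun (U : GaugeField P j U1) (φ : HiggsField P j) =>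
      (Obs31.printed plaq bond site ε e₀ d (fun i _ => cβ i) cξ).eval (cfg U) φ) := by
  intro g U φ
  show (Obs31.printed plaq bond site ε e₀ d (fun i _ => cβ i) cξ).eval (cfg (GaugeField.gaugeAct g U)) (twist g φ) = _
  have ht : twist g φ = gaugePhi (fun x => arg (toC (g x))) φ := rot_eq_gaugePhi g φ
  rw [cfg_gaugeAct, ht, printed_eval_gauge]

/-- The printed observable is jointly continuous in the ℂ-valued bond field and the scalar field. [cite: BalabanImbrieJaffe1988, (3.1) p.265] -/
theorem continuous_printed_eval :
    Continuous fun q : (PBond P j → ℂ) × HiggsField P j =>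
      (Obs31.printed plaq bond site ε e₀ d (fun i _ => cβ i) cξ).eval q.1 q.2 := by
  unfold Obs31.eval Obs31.printed plaqVar
  simp only
  fun_prop

/-- … hence jointly measurable on `U(1)` configurations × scalar fields — the hypothesis `hFm` of `isRT311_printed`. [cite: BalabanImbrieJaffe1988, (3.1) p.265] -/
theorem measurable_printed :
    Measurable (Function.uncurry fun (U : GaugeField P j U1) (φ : HiggsField P j) =>
      (Obs31.printed plaq bond site ε e₀ d (fun i _ => cβ i) cξ).eval (cfg U) φ) := by
  have hcfg : Measurable (cfg : GaugeField P j U1 → PBond P j → ℂ) :=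
    measurable_pi_lambda _ fun b => BIJ85RT33.continuous_toC.measurable.comp (measurable_pi_apply b)
  have hq : Measurable fun p : GaugeField P j U1 × HiggsField P j => (cfg p.1, p.2) :=
    (hcfg.comp measurable_fst).prodMk measurable_snd
  have heq : (Function.uncurry fun (U : GaugeField P j U1) (φ : HiggsField P j) =>
      (Obs31.printed plaq bond site ε e₀ d (fun i _ => cβ i) cξ).eval (cfg U) φ) =
      (fun q : (PBond P j → ℂ) × HiggsField P j => (Obs31.printed plaq bond site ε e₀ d (fun i _ => cβ i) cξ).eval q.1 q.2) ∘
        fun p : GaugeField P j U1 × HiggsField P j => (cfg p.1, p.2) := by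
    funext p; rfl
  rw [heq]
  exact (continuous_printed_eval plaq bond site ε e₀ d cβ cξ).measurable.comp hq

/-- Bookkeeping: `1 + |φ(y)| ≤ Π_x (1 + |φ(x)|)`. [cite: BalabanImbrieJaffe1988, (3.1) p.265] -/
theorem one_add_norm_le_prod (φ : HiggsField P j) (y : Balaban1983to89.Site P j) :
    1 + ‖φ y‖ ≤ ∏ x, (1 + ‖φ x‖) := by
  have h : ∏ x, (if x = y then 1 + ‖φ x‖ else 1) = 1 + ‖φ y‖ := by
    rw [prod_ite_eq']; simp
  rw [← h]
  exact prod_le_prod (fun x _ => by split_ifs <;> positivity) fun x _ => by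
    split_ifs <;> nlinarith [norm_nonneg (φ x)]

/-- A plaquette variable of a unit-modulus bond field has modulus one. [cite: BalabanImbrieJaffe1988, (3.3) p.265] -/
theorem norm_plaqVar_eq_one {u : PBond P j → ℂ} (hu : ∀ b, ‖u b‖ = 1) (p : Balaban1983to89.Plaq P j) : ‖plaqVar u p‖ = 1 := by
  simp [plaqVar, hu]

/-- **Polynomial bound** of the printed observable for unit-modulus `u`: `‖F(u, φ)‖ ≤ C·Π_x(1 + |φ(x)|)ⁿ` with
`C = (2|(ie₀)⁻¹||ε^{−d/2}|)^{|π(F)|}·Π(1 + |c_β|)·Π(1 + |c_ξ|)`, `n = 2(|β(F)| + |ξ(F)|)` — the hypothesis `hF` of `isRT311_printed`.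
[cite: BalabanImbrieJaffe1988, (3.1) p.265] -/
theorem norm_printed_eval_le {u : PBond P j → ℂ} (hu : ∀ b, ‖u b‖ = 1) (φ : HiggsField P j) :
    ‖(Obs31.printed plaq bond site ε e₀ d (fun i _ => cβ i) cξ).eval u φ‖ ≤
      ((2 * ‖((I * e₀)⁻¹ : ℂ)‖ * |ε ^ (-(d : ℝ) / 2)|) ^ Fintype.card ιπ * (∏ i, (1 + ‖cβ i‖)) * ∏ i, (1 + ‖cξ i‖)) *
        ∏ x, (1 + ‖φ x‖) ^ (2 * (Fintype.card ιβ + Fintype.card ιξ)) := by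
  set Pp := ∏ x, (1 + ‖φ x‖) with hPp
  have hPp1 : 1 ≤ Pp := by
    have h1 : ∏ x : Balaban1983to89.Site P j, (1 : ℝ) ≤ Pp :=
      prod_le_prod (fun _ _ => zero_le_one) fun x _ => by nlinarith [norm_nonneg (φ x)]
    simpa using h1
  have hPp0 : 0 ≤ Pp := zero_le_one.trans hPp1
  have hφ : ∀ y, ‖φ y‖ ≤ Pp := fun y => by linarith [one_add_norm_le_prod φ y, norm_nonneg (φ y)]
  set Cπ := 2 * ‖((I * e₀)⁻¹ : ℂ)‖ * |ε ^ (-(d : ℝ) / 2)| with hCπ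
  -- plaquette factors
  have hP : ∀ i, ‖(Obs31.printed plaq bond site ε e₀ d (fun i _ => cβ i) cξ).Fp i u‖ ≤ Cπ := by
    intro i
    simp only [Obs31.printed, Complex.norm_real, Real.norm_eq_abs]
    refine (abs_re_le_norm _).trans ?_
    rw [norm_mul, norm_mul, Complex.norm_real, Real.norm_eq_abs]
    have h2 : ‖plaqVar u (plaq i) - 1‖ ≤ 2 := by
      refine (norm_sub_le _ _).trans ?_
      rw [norm_plaqVar_eq_one hu, norm_one]; norm_num
    calc ‖((I * e₀)⁻¹ : ℂ)‖ * |ε ^ (-(d : ℝ) / 2)| * ‖plaqVar u (plaq i) - 1‖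
        ≤ ‖((I * e₀)⁻¹ : ℂ)‖ * |ε ^ (-(d : ℝ) / 2)| * 2 := by gcongr
      _ = Cπ := by rw [hCπ]; ring
  -- bond factors
  have hB : ∀ i, ‖(Obs31.printed plaq bond site ε e₀ d (fun i _ => cβ i) cξ).Wb i u φ‖ ≤ (1 + ‖cβ i‖) * Pp ^ 2 := by
    intro i
    simp only [Obs31.printed]
    refine (norm_sub_le _ _).trans ?_
    rw [norm_mul, norm_mul, Complex.norm_conj, hu, mul_one]
    have h1 : ‖φ (bond i).src‖ * ‖φ (bond i).tgt‖ ≤ Pp * Pp :=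
      mul_le_mul (hφ _) (hφ _) (norm_nonneg _) hPp0
    have h2 : ‖cβ i‖ ≤ ‖cβ i‖ * Pp ^ 2 := le_mul_of_one_le_right (norm_nonneg _) (one_le_pow₀ hPp1)
    have hsq : Pp * Pp = Pp ^ 2 := (sq Pp).symm
    linarith [h1, h2, hsq]
  -- site factors
  have hV : ∀ i, ‖(Obs31.printed plaq bond site ε e₀ d (fun i _ => cβ i) cξ).Vx i φ‖ ≤ (1 + ‖cξ i‖) * Pp ^ 2 := by
    intro i
    simp only [Obs31.printed]
    refine (norm_sub_le _ _).trans ?_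
    rw [Complex.norm_real, Real.norm_eq_abs, abs_of_nonneg (by positivity)]
    have h1 : ‖φ (site i)‖ ^ 2 ≤ Pp ^ 2 := pow_le_pow_left₀ (norm_nonneg _) (hφ _) 2
    have h2 : ‖cξ i‖ ≤ ‖cξ i‖ * Pp ^ 2 := le_mul_of_one_le_right (norm_nonneg _) (one_le_pow₀ hPp1)
    linarith [h1, h2]
  -- assemble
  rw [Obs31.eval, norm_mul, norm_mul, norm_prod, norm_prod, norm_prod]
  have e1 : ∏ i, ‖(Obs31.printed plaq bond site ε e₀ d (fun i _ => cβ i) cξ).Fp i u‖ ≤ Cπ ^ Fintype.card ιπ := by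
    rw [← Finset.card_univ, ← Finset.prod_const]
    exact prod_le_prod (fun _ _ => norm_nonneg _) fun i _ => hP i
  have e2 : ∏ i, ‖(Obs31.printed plaq bond site ε e₀ d (fun i _ => cβ i) cξ).Wb i u φ‖ ≤
      (∏ i, (1 + ‖cβ i‖)) * Pp ^ (2 * Fintype.card ιβ) := by
    rw [pow_mul, ← Finset.card_univ, ← Finset.prod_const, ← prod_mul_distrib]
    exact prod_le_prod (fun _ _ => norm_nonneg _) fun i _ => hB i
  have e3 : ∏ i, ‖(Obs31.printed plaq bond site ε e₀ d (fun i _ => cβ i) cξ).Vx i φ‖ ≤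
      (∏ i, (1 + ‖cξ i‖)) * Pp ^ (2 * Fintype.card ιξ) := by
    rw [pow_mul, ← Finset.card_univ, ← Finset.prod_const, ← prod_mul_distrib]
    exact prod_le_prod (fun _ _ => norm_nonneg _) fun i _ => hV i
  have hC0 : 0 ≤ Cπ ^ Fintype.card ιπ := by positivity
  have hW0 : 0 ≤ ∏ i, ‖(Obs31.printed plaq bond site ε e₀ d (fun i _ => cβ i) cξ).Wb i u φ‖ :=
    prod_nonneg fun _ _ => norm_nonneg _
  have hV0 : 0 ≤ ∏ i, ‖(Obs31.printed plaq bond site ε e₀ d (fun i _ => cβ i) cξ).Vx i φ‖ :=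
    prod_nonneg fun _ _ => norm_nonneg _
  calc (∏ i, ‖(Obs31.printed plaq bond site ε e₀ d (fun i _ => cβ i) cξ).Fp i u‖) *
        (∏ i, ‖(Obs31.printed plaq bond site ε e₀ d (fun i _ => cβ i) cξ).Wb i u φ‖) *
        ∏ i, ‖(Obs31.printed plaq bond site ε e₀ d (fun i _ => cβ i) cξ).Vx i φ‖
      ≤ Cπ ^ Fintype.card ιπ * ((∏ i, (1 + ‖cβ i‖)) * Pp ^ (2 * Fintype.card ιβ)) *
          ((∏ i, (1 + ‖cξ i‖)) * Pp ^ (2 * Fintype.card ιξ)) := by gcongr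
    _ = (Cπ ^ Fintype.card ιπ * (∏ i, (1 + ‖cβ i‖)) * ∏ i, (1 + ‖cξ i‖)) *
          Pp ^ (2 * (Fintype.card ιβ + Fintype.card ιξ)) := by ring
    _ = _ := by rw [hPp, ← prod_pow]

/-- … on `U(1)` configurations (`|u(b)| = 1` by `norm_toC`). [cite: BalabanImbrieJaffe1988, (3.1) p.265] -/
theorem norm_printed_eval_cfg_le (U : GaugeField P j U1) (φ : HiggsField P j) :
    ‖(Obs31.printed plaq bond site ε e₀ d (fun i _ => cβ i) cξ).eval (cfg U) φ‖ ≤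
      ((2 * ‖((I * e₀)⁻¹ : ℂ)‖ * |ε ^ (-(d : ℝ) / 2)|) ^ Fintype.card ιπ * (∏ i, (1 + ‖cβ i‖)) * ∏ i, (1 + ‖cξ i‖)) *
        ∏ x, (1 + ‖φ x‖) ^ (2 * (Fintype.card ιβ + Fintype.card ιξ)) :=
  norm_printed_eval_le plaq bond site ε e₀ d cβ cξ (fun b => norm_toC (U b)) φ


/-- **(3.11) for the printed model AND the printed observables, no hypothesis on `F` left**: `ρ₁^L := 𝒯ρ₀` (gen 4
`BIJ85BlockAveragesTorus.isRT311_printed` with `hFm`, `hFg`, `hF` discharged above). [cite: BalabanImbrieJaffe1988, (3.11) p.266] -/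
theorem isRT311_printed_obs (hj : j + 1 ≤ P.m + P.K) (hd : 2 ≤ P.d) {a : ℝ} (ha : 0 < a) (hε : 0 < ε) (e : ℝ)
    {lam : ℝ} (hlam : 0 < lam) (dm2 E₀ E₁ : ℝ) :
    IsRT311 BIJ85BlockAveragesTorus.qU BIJ85BlockAveragesTorus.qCov a
      (rho0 ε e lam dm2 E₀ E₁ (fun U φ => (Obs31.printed plaq bond site ε e₀ d (fun i _ => cβ i) cξ).eval (cfg U) φ))
      ((BIJ85BlockAveragesTorus.torusRTData hj).rt (BIJ88RT311Exists.gaussApprox ha hd)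
        (rho0 ε e lam dm2 E₀ E₁ (fun U φ => (Obs31.printed plaq bond site ε e₀ d (fun i _ => cβ i) cξ).eval (cfg U) φ))) :=
  BIJ85BlockAveragesTorus.isRT311_printed hj hd ha hε e hlam dm2 E₀ E₁ (measurable_printed plaq bond site ε e₀ d cβ cξ)
    (jointInvariant_printed plaq bond site ε e₀ d cβ cξ) (norm_printed_eval_cfg_le plaq bond site ε e₀ d cβ cξ)

/-- **(3.22) FOR THE PRINTED MODEL AND OBSERVABLES**: for `ε, λ, a > 0`, `d ≥ 2`, the standing level range, any Wick constants,
any cube structure `(κ, R, cube)` with `R` symmetric, any cube characteristic values `χ`, `n̄`, and any distribution `E₁(x)` of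
`E₁`, there is a density `ρ₁^L` satisfying (3.11) for `ρ₀ = F e^{−S}` (`rho0`) AND (3.22) `Eq322` with the constructed terms of
`BIJ88Eq322Identity` (`eq322_model`). [cite: BalabanImbrieJaffe1988, (3.22) p.268] -/
theorem exists_eq322_printed (hj : j + 1 ≤ P.m + P.K) (hd : 2 ≤ P.d) {a : ℝ} (ha : 0 < a) (hε : 0 < ε) (e : ℝ)
    {lam : ℝ} (hlam : 0 < lam) (dm2 E₀ E₁ : ℝ) {E₁x : Balaban1983to89.Site P j → ℝ} (hE₁ : ∑ x, E₁x x = E₁)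
    {κ : Type} [DecidableEq κ] [Fintype κ] {R : κ → κ → Prop} [DecidableRel R] (hR : ∀ x y, R x y → R y x)
    (cube : Balaban1983to89.Site P j → κ) (nhalf : ℕ)
    (χ : κ → (PBond P j → ℂ) → HiggsField P j → (Balaban1983to89.Site P (j + 1) → ℂ) → ℝ) :
    ∃ ρ₁ : GaugeField P (j + 1) U1 → (Balaban1983to89.Site P (j + 1) → ℂ) → ℂ,
      IsRT311 BIJ85BlockAveragesTorus.qU BIJ85BlockAveragesTorus.qCov a
        (rho0 ε e lam dm2 E₀ E₁ (fun U φ => (Obs31.printed plaq bond site ε e₀ d (fun i _ => cβ i) cξ).eval (cfg U) φ)) ρ₁ ∧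
      Eq322 BIJ85BlockAveragesTorus.qU BIJ85BlockAveragesTorus.qCov a (terms R)
        (term322 R cube ((Obs31.printed plaq bond site ε e₀ d (fun i _ => cβ i) cξ).rescale (BIJ88Sect3Rescaling.phiScale ε P.d))
          (BIJ85Sect1Model.eEps e ε P.d) nhalf (P0eps ε lam P.d) (-dm2) ε E₁x χ
          (calE0 E₀ P.d (Fintype.card (Balaban1983to89.Site P j)) ε)) ρ₁ :=
  ⟨_, isRT311_printed_obs plaq bond site ε e₀ d cβ cξ hj hd ha hε e hlam dm2 E₀ E₁,
    eq322_model hR cube _ nhalf χ hε e lam dm2 E₀ E₁ hE₁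
      (isRT311_printed_obs plaq bond site ε e₀ d cβ cξ hj hd ha hε e hlam dm2 E₀ E₁)⟩

end

end Literature.MathematicalPhysics.QuantumFieldTheory.BalabanImbrieJaffe1984to88.BIJ88Eq322Printed
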